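import Mathlib.LinearAlgebra.Matrix.Rank
import Mathlib.RingTheory.MvPolynomial.Ideal
import Mathlib.LinearAlgebra.FiniteDimensional.Defs
import Literature.Barriers.ValiantsHypothesis.PartialDerivativesDetPerm
import Literature.Computability.AlgebraicComplexity.ApolarityAction

/-!
# Tools for `DepthThreeRung` (item stmt-ValiantsHypothesis-11568, route ForgivenCollisions)

Generic lemmas for the garbage-immune partial-derivative bound on homogeneous `ΣΠΣ` circuits
(Nisan–Wigderson 1996): coefficients of iterated partial derivatives, the Leibniz rule for a
product of linear forms (its `k`-th derivatives lie in the span of the `binom(n,k)` sub-products),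
the resulting rank bound for the coefficient matrix of one product gate, rank subadditivity, and
the dictionary "`f - g` in a monomial ideal with upward-closed exponent set ⇒ equal coefficients
off that set".

## References

* N. Nisan, A. Wigderson, *Lower bounds on arithmetic circuits via partial derivatives*,
  Comput. Complexity 6 (1996/97), Thm. 1 / §3 [NisanWigderson1996].
-/

noncomputable section

-- `Summit.ValiantsHypothesis.ValiantsHypothesis.…` is the tree's single-conjunct layout (Sub = Summit).
set_option linter.dupNamespace false

namespace Summit.ValiantsHypothesis.ValiantsHypothesis.Theorems.ForgivenCollisionsDepthThreeRung

open MvPolynomial Finset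
open Literature.Computability.AlgebraicComplexity
open Literature.Barriers.ValiantsHypothesis

/-! ### Coefficients of iterated partial derivatives -/

section Coeff

variable {K : Type*} [CommRing K] {σ : Type*}

/-- `(∂ᵢ g)_u = (uᵢ + 1) · g_{u + eᵢ}`. [folklore] -/
theorem coeff_pderiv_eq (i : σ) (g : MvPolynomial σ K) (u : σ →₀ ℕ) :
    coeff u (pderiv i g) = ((u i + 1 : ℕ) : K) * coeff (u + Finsupp.single i 1) g := by
  rw [← apolarAction_X]
  exact coeff_apolarAction_X i g u

variable [DecidableEq σ]

/-- Coefficients of an iterated derivative along DISTINCT variables `l`: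
`(∂_l f)_u = (∏_{v ∈ l} (u_v + 1)) · f_{u + 𝟙_l}`. [folklore] -/
theorem coeff_iterPDeriv (l : List σ) (hl : l.Nodup) (f : MvPolynomial σ K) (u : σ →₀ ℕ) :
    coeff u (iterPDeriv l f) =
      (∏ v ∈ l.toFinset, ((u v + 1 : ℕ) : K)) * coeff (u + sqfree l.toFinset) f := by
  induction l generalizing u with
  | nil => simp [sqfree]
  | cons v l ih =>
    obtain ⟨hv, hl'⟩ := List.nodup_cons.1 hl
    have hv' : v ∉ l.toFinset := fun h => hv (List.mem_toFinset.1 h)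
    rw [iterPDeriv_cons, coeff_pderiv_eq, ih hl' (u + Finsupp.single v 1), List.toFinset_cons,
      Finset.prod_insert hv']
    have hsq : sqfree (insert v l.toFinset) = Finsupp.single v 1 + sqfree l.toFinset := by
      simp only [sqfree, Finset.sum_insert hv']
    have hprod : ∏ w ∈ l.toFinset, (((u + Finsupp.single v 1 : σ →₀ ℕ) w + 1 : ℕ) : K) =
        ∏ w ∈ l.toFinset, ((u w + 1 : ℕ) : K) := by
      refine Finset.prod_congr rfl fun w hw => ?_
      have hvw : v ≠ w := fun h => hv' (h ▸ hw)
      rw [Finsupp.add_apply, Finsupp.single_apply, if_neg hvw, add_zero]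
    rw [hprod, hsq, add_assoc]
    ring

end Coeff

/-! ### Derivatives of a product of linear forms -/

section Leibniz

variable {K : Type*} [Field K] {σ : Type*}

/-- The derivative of a linear form `Σ_w c_w x_w` in `x_v` is the constant `c_v`. [folklore] -/
theorem pderiv_linearForm [Fintype σ] [DecidableEq σ] (c : σ → K) (v : σ) :
    pderiv v (∑ w, c w • (X w : MvPolynomial σ K)) = C (c v) := by
  rw [map_sum, Finset.sum_eq_single v]
  · rw [Derivation.map_smul, pderiv_X_self, smul_eq_C_mul, mul_one]
  · intro w _ hw
    rw [Derivation.map_smul, pderiv_X_of_ne hw, smul_zero]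
  · intro h
    exact absurd (Finset.mem_univ v) h

/-- Leibniz rule for a finite product: `∂ᵥ ∏ᵢ fᵢ = Σᵢ (∏_{k ≠ i} f_k) · ∂ᵥ fᵢ`. [folklore] -/
theorem pderiv_prod {ι : Type*} [DecidableEq ι] (s : Finset ι) (f : ι → MvPolynomial σ K) (v : σ) :
    pderiv v (∏ i ∈ s, f i) = ∑ i ∈ s, (∏ k ∈ s.erase i, f k) * pderiv v (f i) := by
  induction s using Finset.induction_on with
  | empty => simp
  | insert a s ha ih =>
    rw [Finset.prod_insert ha, pderiv_mul, ih, Finset.sum_insert ha, Finset.erase_insert ha,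
      Finset.mul_sum]
    have hterm : ∀ i ∈ s, f a * ((∏ k ∈ s.erase i, f k) * pderiv v (f i)) =
        (∏ k ∈ (insert a s).erase i, f k) * pderiv v (f i) := by
      intro i hi
      have hia : i ≠ a := fun h => ha (h ▸ hi)
      rw [Finset.erase_insert_of_ne hia.symm,
        Finset.prod_insert (fun h => ha (Finset.mem_of_mem_erase h))]
      ring
    rw [Finset.sum_congr rfl hterm, mul_comm (pderiv v (f a))]

/-- **Derivatives of a product of linear forms.** If every `ℓᵢ` is a linear form
(`∂ᵥ ℓᵢ = c i v`), then every iterated derivative of `∏_{i ∈ s} ℓᵢ` along a list of `k`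
variables lies in the span of the sub-products `∏_{i ∈ S} ℓᵢ`, `S ⊆ s`, `|S| = |s| - k`
(Nisan–Wigderson 1996, proof of Thm. 1). [cite: NisanWigderson1996, Thm. 1] -/
theorem iterPDeriv_prod_mem_span {ι : Type*} [DecidableEq ι] (s : Finset ι)
    (ℓ : ι → MvPolynomial σ K) (c : ι → σ → K) (hℓ : ∀ i v, pderiv v (ℓ i) = C (c i v))
    (l : List σ) :
    iterPDeriv l (∏ i ∈ s, ℓ i) ∈ Submodule.span K
      ((fun S => ∏ i ∈ S, ℓ i) '' ↑(s.powersetCard (s.card - l.length))) := by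
  induction l with
  | nil =>
    refine Submodule.subset_span ⟨s, ?_, rfl⟩
    simp
  | cons v l ih =>
    rw [iterPDeriv_cons]
    have key : Submodule.span K ((fun S => ∏ i ∈ S, ℓ i) '' ↑(s.powersetCard (s.card - l.length)))
        ≤ (Submodule.span K ((fun S => ∏ i ∈ S, ℓ i) ''
            ↑(s.powersetCard (s.card - (v :: l).length)))).comap
          ((pderiv v : Derivation K (MvPolynomial σ K) (MvPolynomial σ K)) :
            MvPolynomial σ K →ₗ[K] MvPolynomial σ K) := by
      rw [Submodule.span_le]
      rintro _ ⟨S, hS, rfl⟩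
      rw [Finset.mem_coe, Finset.mem_powersetCard] at hS
      rw [SetLike.mem_coe, Submodule.mem_comap, Derivation.coeFn_coe, pderiv_prod]
      refine Submodule.sum_mem _ fun i hi => ?_
      rw [hℓ, mul_comm, ← smul_eq_C_mul]
      refine Submodule.smul_mem _ _ (Submodule.subset_span ⟨S.erase i, ?_, rfl⟩)
      rw [Finset.mem_coe, Finset.mem_powersetCard]
      refine ⟨(Finset.erase_subset i S).trans hS.1, ?_⟩
      rw [Finset.card_erase_of_mem hi, hS.2, List.length_cons]
      omega
    have := key ih
    rwa [Submodule.mem_comap, Derivation.coeFn_coe] at this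

/-- **Rank bound for one product gate** (Nisan–Wigderson 1996, Thm. 1): for a product of `n`
linear forms `g = ∏ᵢ ℓᵢ`, any matrix whose rows are coefficient vectors of `j`-th order iterated
derivatives of `g` (`j ≤ n`) has rank at most `binom(n, j)`. [cite: NisanWigderson1996, Thm. 1] -/
theorem rank_coeff_iterPDeriv_prod_le {A B : Type*} [Fintype A] [Fintype B] {n j : ℕ} (hj : j ≤ n)
    (ℓ : Fin n → MvPolynomial σ K) (c : Fin n → σ → K) (hℓ : ∀ i v, pderiv v (ℓ i) = C (c i v))
    (L : A → List σ) (hL : ∀ a, (L a).length = j) (β : B → σ →₀ ℕ) :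
    (Matrix.of fun a b => coeff (β b) (iterPDeriv (L a) (∏ i, ℓ i))).rank ≤ n.choose j := by
  classical
  set T : Finset (MvPolynomial σ K) :=
    ((Finset.univ : Finset (Fin n)).powersetCard (n - j)).image (fun S => ∏ i ∈ S, ℓ i) with hT
  set W : Submodule K (MvPolynomial σ K) := Submodule.span K (T : Set (MvPolynomial σ K)) with hW
  set Φ : MvPolynomial σ K →ₗ[K] (B → K) := LinearMap.pi fun b => lcoeff K (β b) with hΦ
  have hmem : ∀ a, iterPDeriv (L a) (∏ i, ℓ i) ∈ W := by
    intro a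
    have h := iterPDeriv_prod_mem_span Finset.univ ℓ c hℓ (L a)
    rwa [Finset.card_univ, Fintype.card_fin, hL a, ← Finset.coe_image] at h
  have h1 : Submodule.span K (Set.range
      (Matrix.of fun a b => coeff (β b) (iterPDeriv (L a) (∏ i, ℓ i))).row) ≤ W.map Φ := by
    rw [Submodule.span_le]
    rintro _ ⟨a, rfl⟩
    exact ⟨_, hmem a, rfl⟩
  rw [Matrix.rank_eq_finrank_span_row]
  calc Module.finrank K _ ≤ Module.finrank K (W.map Φ) := Submodule.finrank_mono h1
    _ ≤ Module.finrank K W := Submodule.finrank_map_le Φ W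
    _ ≤ T.card := finrank_span_finset_le_card T
    _ ≤ ((Finset.univ : Finset (Fin n)).powersetCard (n - j)).card := Finset.card_image_le
    _ = n.choose j := by
      rw [Finset.card_powersetCard, Finset.card_univ, Fintype.card_fin, Nat.choose_symm hj]

/-- `rank (Σ Aᵢ) ≤ Σ rank Aᵢ` (rank subadditivity, iterated). [folklore] -/
theorem rank_sum_le {m p : Type*} [Fintype p] {ι : Type*} (s : Finset ι) (A : ι → Matrix m p K) :
    (∑ i ∈ s, A i).rank ≤ ∑ i ∈ s, (A i).rank := by
  classical
  induction s using Finset.induction_on with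
  | empty => simp [Matrix.rank_zero]
  | insert a s ha ih =>
    rw [Finset.sum_insert ha, Finset.sum_insert ha]
    have hadd : (A a + ∑ i ∈ s, A i).rank ≤ (A a).rank + (∑ i ∈ s, A i).rank := by
      unfold Matrix.rank
      rw [Matrix.mulVecLin_add]
      exact (Submodule.finrank_mono (LinearMap.range_add_le _ _)).trans
        (Submodule.finrank_add_le_finrank_add_finrank _ _)
    exact hadd.trans (Nat.add_le_add_left ih _)

end Leibniz

/-! ### Monomial ideals with upward-closed exponent sets -/

section Ideal

variable {K : Type*} [CommRing K] {σ : Type*}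

/-- **Dictionary.** If `f - g` lies in the ideal spanned by the monomials with exponents in an
upward-closed set `Bad`, then `f` and `g` have the same coefficient at every exponent outside
`Bad` (`MvPolynomial.mem_ideal_span_monomial_image`). [folklore] -/
theorem coeff_eq_of_sub_mem_span {Bad : (σ →₀ ℕ) → Prop}
    (hup : ∀ ⦃d d' : σ →₀ ℕ⦄, d ≤ d' → Bad d → Bad d') {f g : MvPolynomial σ K}
    (h : f - g ∈ Ideal.span ((fun d : σ →₀ ℕ => monomial d (1 : K)) '' {d | Bad d}))
    {d : σ →₀ ℕ} (hd : ¬ Bad d) : coeff d f = coeff d g := by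
  rw [mem_ideal_span_monomial_image] at h
  have : coeff d (f - g) = 0 := by
    by_contra hne
    obtain ⟨si, hsi, hle⟩ := h d (mem_support_iff.2 hne)
    exact hd (hup hle hsi)
  rwa [coeff_sub, sub_eq_zero] at this

end Ideal

end Summit.ValiantsHypothesis.ValiantsHypothesis.Theorems.ForgivenCollisionsDepthThreeRung
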